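import Summits.Schanuel.Schanuel.Theorems.ZilberEacNearResonantDefs
import Mathlib.Analysis.Calculus.ImplicitFunction.ProdDomain
import Mathlib.Analysis.Calculus.ContDiff.RCLike
import Mathlib.Analysis.SpecialFunctions.ExpDeriv
import Mathlib.Topology.Algebra.Module.FiniteDimension
import Mathlib.Analysis.Complex.Basic
import HarnessLib

/-!
# The near-resonant regime: implicit-function continuation of the rescaled limit system

Zilber's Exponential-Algebraic Closedness, case ladder (host summit Schanuel, cell `pub-schanuel`,
seat 2, gen 13).  For the critical-size family `x₂ = r₀x₀ + r₁x₁` (`r₀ + r₁ = 1`), `yⱼ = xⱼ + y₂`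
the rescaled system `nrF` (see `ZilberEacNearResonantDefs`) is ENTIRE in parameters
`(ε, s, ℓ)` and unknowns `(δ₀, δ₁, τ)`.  At a solution with `s = ℓ = 0` its partial derivative in
the unknowns is `nrL e₀ e₁ c₀ c₁ r₀ r₁` with `eⱼ = e^{δⱼ} = 1 + Aⱼσ`, `cⱼ = σAⱼ`, `σ = e^{-τ}`
(`hasFDerivAt_nrF_unknowns`), whose kernel is trivial as soon as `σ ≠ 0`, `A₀A₁ ≠ 0`,
`r₀ + r₁ ≠ 0` and `r₀A₀ + r₁A₁ = 0` (`nrL_injective`: the `O(1)` part of the determinant,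
`r₀A₀ + r₁A₁`, VANISHES — this is the criticality — but the `O(σ)` part `σ²A₀A₁(r₀ + r₁)`
survives).  Mathlib's implicit function theorem on a product domain
(`HasStrictFDerivAt.implicitFunctionOfProdDomain`) then continues the limit solution to a
CONTINUOUS solution map on a neighbourhood of the parameter `(ε, 0, 0)`
(**`exists_implicit_nearResonant`**).  Labels `(d, n₁)` with `(r₀d + n₁, 1/d, log d/d)` in that
neighbourhood give honest solutions of `e^{xⱼ} = xⱼ + e^{x₂}` (`ZilberEacNearResonantExistence`).

HONEST FRAMING: an existence mechanism for explicit members of an OPEN cell (`ECCell 3 2`);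
NOT Schanuel's conjecture; EAC ⇏ SC.
-/

noncomputable section

open Complex Filter Topology

set_option linter.dupNamespace false

namespace Summit.Schanuel.Schanuel.Theorems

section System

variable (r₀ r₁ A₀ A₁ B : ℂ)

/-- `nrF` is smooth (entire). [folklore] -/
theorem contDiff_nrF : ContDiff ℂ 1 (nrF r₀ r₁ A₀ A₁ B) := by
  unfold nrF
  fun_prop

/-- **The partial derivative of `nrF` in the unknowns** at parameters `(ε, 0, 0)` is
`nrL (e^{δ₀}) (e^{δ₁}) (e^{-τ}A₀) (e^{-τ}A₁) r₀ r₁`. [folklore] -/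
theorem hasFDerivAt_nrF_unknowns (ε : ℂ) (q : ℂ × ℂ × ℂ) :
    HasFDerivAt (fun q' : ℂ × ℂ × ℂ => nrF r₀ r₁ A₀ A₁ B ((ε, 0, 0), q'))
      (nrL (exp q.1) (exp q.2.1) (exp (-q.2.2) * A₀) (exp (-q.2.2) * A₁) r₀ r₁) q := by
  have e : (fun q' : ℂ × ℂ × ℂ => nrF r₀ r₁ A₀ A₁ B ((ε, 0, 0), q')) = fun q' =>
      (exp q'.1 - 1 - exp (-q'.2.2) * A₀, exp q'.2.1 - 1 - exp (-q'.2.2) * A₁,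
        r₀ * q'.1 + r₁ * q'.2.1 + B * ε) := by
    funext q'; exact nrF_param_zero r₀ r₁ A₀ A₁ B ε q'
  rw [e]
  have h1 : HasFDerivAt (fun q' : ℂ × ℂ × ℂ => q'.1) (ContinuousLinearMap.fst ℂ ℂ (ℂ × ℂ)) q :=
    hasFDerivAt_fst
  have h2 : HasFDerivAt (fun q' : ℂ × ℂ × ℂ => q'.2.1)
      ((ContinuousLinearMap.fst ℂ ℂ ℂ).comp (ContinuousLinearMap.snd ℂ ℂ (ℂ × ℂ))) q :=
    hasFDerivAt_fst.comp q hasFDerivAt_snd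
  have h3 : HasFDerivAt (fun q' : ℂ × ℂ × ℂ => q'.2.2)
      ((ContinuousLinearMap.snd ℂ ℂ ℂ).comp (ContinuousLinearMap.snd ℂ ℂ (ℂ × ℂ))) q :=
    hasFDerivAt_snd.comp q hasFDerivAt_snd
  have c0 := (h1.cexp.sub_const 1).sub (h3.neg.cexp.mul_const A₀)
  have c1 := (h2.cexp.sub_const 1).sub (h3.neg.cexp.mul_const A₁)
  have c2 := ((h1.const_mul r₀).add (h2.const_mul r₁)).add_const (B * ε)
  refine (c0.prodMk (c1.prodMk c2)).congr_fderiv ?_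
  ext <;> simp <;> ring

/-- **Trivial kernel of the partial derivative at critical size.**  With `eⱼ = 1 + Aⱼσ ≠ 0`,
`cⱼ = σAⱼ`, `σ ≠ 0`, `A₀A₁ ≠ 0`, `r₀ + r₁ ≠ 0` and the critical cancellation `r₀A₀ + r₁A₁ = 0`
the map `nrL` is injective: from `Lw = 0`, `σ²A₀A₁(r₀ + r₁) w₂ = 0`. [folklore] -/
theorem nrL_injective {σ A₀ A₁ r₀ r₁ e₀ e₁ : ℂ} (hσ : σ ≠ 0) (hA₀ : A₀ ≠ 0) (hA₁ : A₁ ≠ 0)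
    (hsum : r₀ + r₁ ≠ 0) (hcrit : r₀ * A₀ + r₁ * A₁ = 0) (he₀ : e₀ = 1 + A₀ * σ)
    (he₁ : e₁ = 1 + A₁ * σ) (he₀0 : e₀ ≠ 0) (he₁0 : e₁ ≠ 0) :
    Function.Injective (nrL e₀ e₁ (σ * A₀) (σ * A₁) r₀ r₁) := by
  refine (injective_iff_map_eq_zero _).2 fun w hw => ?_
  rw [nrL_apply] at hw
  simp only [Prod.mk_eq_zero] at hw
  obtain ⟨h0, h1, h2⟩ := hw
  have hw2 : σ ^ 2 * A₀ * A₁ * (r₀ + r₁) * w.2.2 = 0 := by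
    rw [he₀] at h0
    rw [he₁] at h1
    linear_combination (r₀ * (1 + A₁ * σ)) * h0 + (r₁ * (1 + A₀ * σ)) * h1 -
      ((1 + A₀ * σ) * (1 + A₁ * σ)) * h2 - (σ * w.2.2) * hcrit
  have hw2' : w.2.2 = 0 := by
    rcases mul_eq_zero.1 hw2 with h | h
    · exfalso
      exact mul_ne_zero (mul_ne_zero (mul_ne_zero (pow_ne_zero 2 hσ) hA₀) hA₁) hsum h
    · exact h
  rw [hw2', mul_zero, add_zero] at h0 h1
  have hw0 : w.1 = 0 := (mul_eq_zero.1 h0).resolve_left he₀0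
  have hw1 : w.2.1 = 0 := (mul_eq_zero.1 h1).resolve_left he₁0
  exact Prod.ext hw0 (Prod.ext hw1 hw2')

/-- **Implicit-function continuation of a limit solution.**  If `q = (δ₀, δ₁, τ)` solves the
rescaled system at parameters `(ε, 0, 0)` and the explicit partial derivative `nrL …` at `q` is
injective, there is a solution map `ψ` on a neighbourhood of `(ε, 0, 0)`:
`nrF (p, ψ p) = 0` for `p` near `(ε, 0, 0)`, and `ψ p → q` as `p → (ε, 0, 0)`
(Mathlib's `implicitFunctionOfProdDomain`). (new) -/
theorem exists_implicit_nearResonant (ε : ℂ) (q : ℂ × ℂ × ℂ)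
    (hq : nrF r₀ r₁ A₀ A₁ B ((ε, 0, 0), q) = 0)
    (hinj : Function.Injective
      (nrL (exp q.1) (exp q.2.1) (exp (-q.2.2) * A₀) (exp (-q.2.2) * A₁) r₀ r₁)) :
    ∃ ψ : ℂ × ℂ × ℂ → ℂ × ℂ × ℂ,
      (∀ᶠ p in 𝓝 ((ε, 0, 0) : ℂ × ℂ × ℂ), nrF r₀ r₁ A₀ A₁ B (p, ψ p) = 0) ∧
      Tendsto ψ (𝓝 ((ε, 0, 0) : ℂ × ℂ × ℂ)) (𝓝 q) := by
  have hcd : ContDiffAt ℂ 1 (nrF r₀ r₁ A₀ A₁ B) (((ε, 0, 0) : ℂ × ℂ × ℂ), q) :=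
    (contDiff_nrF r₀ r₁ A₀ A₁ B).contDiffAt
  have hstrict := hcd.hasStrictFDerivAt one_ne_zero
  have hpart : HasFDerivAt (fun q' : ℂ × ℂ × ℂ => nrF r₀ r₁ A₀ A₁ B ((ε, 0, 0), q'))
      ((fderiv ℂ (nrF r₀ r₁ A₀ A₁ B) (((ε, 0, 0) : ℂ × ℂ × ℂ), q)).comp
        (ContinuousLinearMap.inr ℂ (ℂ × ℂ × ℂ) (ℂ × ℂ × ℂ))) q :=
    hstrict.hasFDerivAt.comp q (hasFDerivAt_prodMk_right (𝕜 := ℂ) ((ε, 0, 0) : ℂ × ℂ × ℂ) q)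
  have hLeq := hpart.unique (hasFDerivAt_nrF_unknowns r₀ r₁ A₀ A₁ B ε q)
  have hinv : ((fderiv ℂ (nrF r₀ r₁ A₀ A₁ B) (((ε, 0, 0) : ℂ × ℂ × ℂ), q)).comp
      (ContinuousLinearMap.inr ℂ (ℂ × ℂ × ℂ) (ℂ × ℂ × ℂ))).IsInvertible := by
    rw [hLeq]
    set L := nrL (exp q.1) (exp q.2.1) (exp (-q.2.2) * A₀) (exp (-q.2.2) * A₁) r₀ r₁ with hL
    have hsurj : Function.Surjective (L : (ℂ × ℂ × ℂ) →ₗ[ℂ] (ℂ × ℂ × ℂ)) :=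
      LinearMap.injective_iff_surjective.1 hinj
    let e : (ℂ × ℂ × ℂ) ≃ₗ[ℂ] (ℂ × ℂ × ℂ) :=
      LinearEquiv.ofBijective (L : (ℂ × ℂ × ℂ) →ₗ[ℂ] (ℂ × ℂ × ℂ)) ⟨hinj, hsurj⟩
    exact ⟨e.toContinuousLinearEquiv, ContinuousLinearMap.ext fun w => rfl⟩
  refine ⟨hstrict.implicitFunctionOfProdDomain hinv, ?_,
    hstrict.tendsto_implicitFunctionOfProdDomain hinv⟩
  have h := hstrict.eventually_apply_implicitFunctionOfProdDomain hinv
  rw [hq] at h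
  exact h

end System

end Summit.Schanuel.Schanuel.Theorems

end
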